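import Summits.MatrixMultiplication.MatrixMultiplication.Theorems.SoloInformedPairLocking

/-!
# THEOREM 8.21* on a box of columns, and the semi-rich poor world (THEOREM 8.22, toward case (β))

This work, §8.8 (T13)(g2) (gen 107). Setting of `SoloInformedRichTranslate`: a CU13-Def-12 realization of `⟨n,n,n⟩`
in `𝒮(S⁰ × S¹, ±)`, coprime case (`G` of odd order, `hG`), arbitrary chart `Φ` into `S⁰ = G₀`, full separation,
class map `κ : G → R` (`r = |R|`) [CohnUmans2013, arXiv:1207.6528, Def. 12].

`SoloInformedTranslateWorld` / `SoloInformedRichTranslate` localised to a BOX `I × J′ × K` of columns: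
* `Data.c_signEq_of_three_on` — the two-value lemma from three columns of `J′`;
* `Data.sq_mul_card_le_card_mul_card_of_translate_on` — the injectivity ending on the box: `n² · |J′| ≤ |S⁰| · |S¹|`;
* `Data.sq_mul_card_le_of_level_on` — the level-set (lazy rows) ending on `J₀ ⊆ J′`;
* `Data.sq_mul_card_le_three_mul_of_locked_rich_on` — THEOREM 8.21* ON A BOX: if every `j ∈ J′` is locked to the
  base `j₀` and the base lines are rich in the sense `(f ≥ 10 ∧ l ≥ 18 values) ∨ (f ≥ 18 ∧ l ≥ 10 values)`, then
  `n² · |J′| ≤ 3 · r · |S⁰|` (connectivity argument in either direction);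
* `Data.sq_mul_card_le_three_mul_of_semirich_row` / `_col` — THE SEMI-RICH POOR WORLD: if `j₀` has a b-row with
  `≥ 18` values and an a-column with `≥ 10` values, then `n² · #{j : column j of a takes ≥ 17 values} ≤ 3 · r · |S⁰|`
  (every such `j` is locked to `j₀` by `Data.locked_of_rich_pair`); and the mirror statement [§8.8 (T13)(g)].
-/

namespace Summit.MatrixMultiplication.MatrixMultiplication.Theorems.TwistedTPP

namespace FibreLines

variable {ι G : Type*} [AddCommGroup G]

/-! ### Box versions of the endings -/

/-- Two-value lemma on a box: three columns of `J′` with distinct `g` make `c` exact everywhere. -/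
theorem Data.c_signEq_of_three_on (hG : ∀ x : G, x = -x → x = 0) (D : Data ι G) (f g l : ι → G)
    (J' : Finset ι) (ha : ∀ i, ∀ j ∈ J', SignEq (D.a i j) (f i + g j))
    (hb : ∀ j ∈ J', ∀ k, SignEq (D.b j k) (l k - g j))
    {j₁ j₂ j₃ : ι} (hj₁ : j₁ ∈ J') (hj₂ : j₂ ∈ J') (hj₃ : j₃ ∈ J')
    (h12 : g j₁ ≠ g j₂) (h13 : g j₁ ≠ g j₃) (h23 : g j₂ ≠ g j₃) (k i : ι) :
    SignEq (D.c k i) (f i + l k) := by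
  by_contra hc
  have h := fun j (hj : j ∈ J') =>
    (signEq_or_of_translate (D.adm_eqn i j k) (ha i j hj) (hb j hj k)).resolve_left hc
  exact not_signEq_three hG (h j₁ hj₁) (h j₂ hj₂) (h j₃ hj₃) h12 h13 h23

variable {G₀ : Type*} [AddCommGroup G₀]

/-- **Injectivity ending on a box.** Exact translates on `I × J′ × K` with full separation:
`n² · |J′| ≤ |S⁰| · |S¹|`. -/
theorem Data.sq_mul_card_le_card_mul_card_of_translate_on [Fintype ι] [DecidableEq ι] [Fintype G₀]
    [DecidableEq G₀] [Fintype G] [DecidableEq G] (D : Data ι G) (Φ : Chart ι G₀) (hsep : D.SepAll Φ)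
    (f g l : ι → G) (J' : Finset ι) (ha : ∀ i, ∀ j ∈ J', SignEq (D.a i j) (f i + g j))
    (hb : ∀ j ∈ J', ∀ k, SignEq (D.b j k) (l k - g j)) (hc : ∀ k i, SignEq (D.c k i) (f i + l k)) :
    Fintype.card ι ^ 2 * J'.card ≤ Fintype.card G₀ * Fintype.card G := by
  classical
  let S : Finset (ι × ι × ι) := Finset.univ ×ˢ (J' ×ˢ Finset.univ)
  let Ψ : S → G₀ × G := fun τ => (Φ.F τ.1.1 τ.1.2.1 τ.1.2.2, f τ.1.1 + g τ.1.2.1 + l τ.1.2.2)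
  have hinj : Function.Injective Ψ := by
    rintro ⟨⟨i, j, k⟩, hτ⟩ ⟨⟨i', j', k'⟩, hτ'⟩ hΨ
    simp only [Ψ, Prod.mk.injEq] at hΨ
    obtain ⟨hF, hG'⟩ := hΨ
    have hj : j ∈ J' := by
      simp only [S, Finset.mem_product, Finset.mem_univ, true_and, and_true] at hτ; exact hτ
    have hj' : j' ∈ J' := by
      simp only [S, Finset.mem_product, Finset.mem_univ, true_and, and_true] at hτ'; exact hτ'
    by_contra hne
    have hne' : (i, j, k) ≠ (i', j', k') := fun h => hne (Subtype.ext h)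
    have hs := hsep i j k i' j' k' hF hne'
    rw [D.sep_iff_not_adm] at hs
    apply hs
    have hadm : Adm (f i + g j) (l k - g j') (f i' + l k') := by
      right; left
      have e : f i + g j + (l k - g j') - (f i' + l k') = (f i + g j + l k) - (f i' + g j' + l k') := by abel
      rw [e, hG', sub_self]
    exact hadm.of_signEq₃ (ha i j hj) (hb j' hj' k) (hc k' i')
  have h := Fintype.card_le_of_injective Ψ hinj
  have hS : Fintype.card S = Fintype.card ι ^ 2 * J'.card := by
    rw [Fintype.card_coe]
    simp only [S, Finset.card_product, Finset.card_univ]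
    ring
  rw [hS, Fintype.card_prod] at h
  exact h

/-- Injectivity ending on a box, rank form: `n² · |J′| ≤ 2 · r · |S⁰|`. -/
theorem Data.sq_mul_card_le_two_mul_of_translate_on [Fintype ι] [DecidableEq ι] [Fintype G₀] [DecidableEq G₀]
    [Fintype G] [DecidableEq G] {R : Type*} [Fintype R] [DecidableEq R] (D : Data ι G) (Φ : Chart ι G₀)
    (κ : G → R) (hκ : ∀ x y, κ x = κ y → SignEq x y) (hsep : D.SepAll Φ) (f g l : ι → G) (J' : Finset ι)
    (ha : ∀ i, ∀ j ∈ J', SignEq (D.a i j) (f i + g j)) (hb : ∀ j ∈ J', ∀ k, SignEq (D.b j k) (l k - g j))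
    (hc : ∀ k i, SignEq (D.c k i) (f i + l k)) :
    Fintype.card ι ^ 2 * J'.card ≤ 2 * (Fintype.card R * Fintype.card G₀) := by
  have h1 := D.sq_mul_card_le_card_mul_card_of_translate_on Φ hsep f g l J' ha hb hc
  have h2 := card_le_two_mul_card_of_signEq κ hκ
  calc Fintype.card ι ^ 2 * J'.card ≤ Fintype.card G₀ * Fintype.card G := h1
    _ ≤ Fintype.card G₀ * (2 * Fintype.card R) := Nat.mul_le_mul_left _ h2
    _ = 2 * (Fintype.card R * Fintype.card G₀) := by ring

/-- Three values of `g` on the box ⟹ `n² · |J′| ≤ 2 · r · |S⁰|`. -/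
theorem Data.sq_mul_card_le_two_mul_of_locked_three_on [Fintype ι] [DecidableEq ι] [Fintype G₀]
    [DecidableEq G₀] [Fintype G] [DecidableEq G] {R : Type*} [Fintype R] [DecidableEq R]
    (hG : ∀ x : G, x = -x → x = 0) (D : Data ι G) (Φ : Chart ι G₀) (κ : G → R)
    (hκ : ∀ x y, κ x = κ y → SignEq x y) (hsep : D.SepAll Φ) (f g l : ι → G) (J' : Finset ι)
    (ha : ∀ i, ∀ j ∈ J', SignEq (D.a i j) (f i + g j)) (hb : ∀ j ∈ J', ∀ k, SignEq (D.b j k) (l k - g j))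
    {j₁ j₂ j₃ : ι} (hj₁ : j₁ ∈ J') (hj₂ : j₂ ∈ J') (hj₃ : j₃ ∈ J')
    (h12 : g j₁ ≠ g j₂) (h13 : g j₁ ≠ g j₃) (h23 : g j₂ ≠ g j₃) :
    Fintype.card ι ^ 2 * J'.card ≤ 2 * (Fintype.card R * Fintype.card G₀) :=
  D.sq_mul_card_le_two_mul_of_translate_on Φ κ hκ hsep f g l J' ha hb
    (D.c_signEq_of_three_on hG f g l J' ha hb hj₁ hj₂ hj₃ h12 h13 h23)

/-- Level-set ending on a box: rows of `b` in a level set `J₀` of `g` agree, so `n² · |J₀| ≤ r · |S⁰|`. -/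
theorem Data.sq_mul_card_le_of_level_on [Fintype ι] [DecidableEq ι] [Fintype G₀] [DecidableEq G₀]
    {R : Type*} [Fintype R] [DecidableEq R] (D : Data ι G) (Φ : Chart ι G₀) (κ : G → R)
    (hκ : ∀ x y, κ x = κ y → SignEq x y) (hsep : D.SepAll Φ) (g l : ι → G) (J₀ : Finset ι)
    (hb : ∀ j ∈ J₀, ∀ k, SignEq (D.b j k) (l k - g j)) (hJ : ∀ j ∈ J₀, ∀ j' ∈ J₀, g j = g j') :
    Fintype.card ι ^ 2 * J₀.card ≤ Fintype.card R * Fintype.card G₀ := by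
  refine D.sq_mul_card_le_of_b_rowsOn Φ κ hκ hsep J₀ ?_
  intro j hj j' hj' k
  have e : l k - g j' = l k - g j := by rw [hJ j hj j' hj']
  exact (hb j' hj' k).trans (e ▸ (hb j hj k).symm)

/-! ### THEOREM 8.21* on a box -/

/-- **THEOREM 8.21\* on a box of columns.** If every column `j ∈ J′` of `a` and row `j ∈ J′` of `b` is locked to
the base `j₀`, and the base lines are rich — `f = a(·,j₀)` takes `≥ 10` values and `l = b(j₀,·)` takes `≥ 18`, or
`f` takes `≥ 18` and `l` takes `≥ 10` — then `n² · |J′| ≤ 3 · r · |S⁰|`. [this work, §8.8 (T13)(g2)] -/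
theorem Data.sq_mul_card_le_three_mul_of_locked_rich_on [Fintype ι] [DecidableEq ι] [Fintype G₀]
    [DecidableEq G₀] [Fintype G] [DecidableEq G] {R : Type*} [Fintype R] [DecidableEq R]
    (hG : ∀ x : G, x = -x → x = 0) (D : Data ι G) (Φ : Chart ι G₀) (κ : G → R)
    (hκ : ∀ x y, κ x = κ y → SignEq x y) (hsep : D.SepAll Φ) (j₀ : ι) (t : ι → G) (J' : Finset ι)
    (ha : ∀ i, ∀ j ∈ J', SignEq (D.a i j) (D.a i j₀ + t j) ∨ SignEq (D.a i j) (D.a i j₀ - t j))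
    (hb : ∀ j ∈ J', ∀ k, SignEq (D.b j k) (D.b j₀ k + t j) ∨ SignEq (D.b j k) (D.b j₀ k - t j))
    (hrich : (10 ≤ ((Finset.univ : Finset ι).image fun i => D.a i j₀).card ∧
        18 ≤ ((Finset.univ : Finset ι).image fun k => D.b j₀ k).card) ∨
      (18 ≤ ((Finset.univ : Finset ι).image fun i => D.a i j₀).card ∧
        10 ≤ ((Finset.univ : Finset ι).image fun k => D.b j₀ k).card)) :
    Fintype.card ι ^ 2 * J'.card ≤ 3 * (Fintype.card R * Fintype.card G₀) := by
  classical
  -- (L1), (L2) on the box after a gauge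
  obtain ⟨f, g, l, ha', hb'⟩ : ∃ f g l : ι → G,
      (∀ i, ∀ j ∈ J', SignEq (D.a i j) (f i + g j)) ∧ (∀ j ∈ J', ∀ k, SignEq (D.b j k) (l k - g j)) := by
    obtain ⟨ε, hε⟩ : ∃ ε : ι → ι → Bool, ∀ i, ∀ j ∈ J', SignEq (D.a i j) (D.a i j₀ + sgn (ε i j) (t j)) := by
      refine ⟨fun i j => decide (SignEq (D.a i j) (D.a i j₀ + t j)), fun i j hj => ?_⟩
      beta_reduce
      by_cases h : SignEq (D.a i j) (D.a i j₀ + t j)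
      · rw [decide_eq_true h, sgn_true]; exact h
      · rw [decide_eq_false h, sgn_false, ← sub_eq_add_neg]; exact (ha i j hj).resolve_left h
    obtain ⟨δ, hδ⟩ : ∃ δ : ι → ι → Bool, ∀ j ∈ J', ∀ k, SignEq (D.b j k) (D.b j₀ k + sgn (δ j k) (t j)) := by
      refine ⟨fun j k => decide (SignEq (D.b j k) (D.b j₀ k + t j)), fun j hj k => ?_⟩
      beta_reduce
      by_cases h : SignEq (D.b j k) (D.b j₀ k + t j)
      · rw [decide_eq_true h, sgn_true]; exact h
      · rw [decide_eq_false h, sgn_false, ← sub_eq_add_neg]; exact (hb j hj k).resolve_left h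
    by_cases hT : ∀ j ∈ J', t j = 0
    · refine ⟨fun i => D.a i j₀, fun _ => 0, fun k => D.b j₀ k, fun i j hj => ?_, fun j hj k => ?_⟩
      · simpa [hT j hj, sgn_zero] using hε i j hj
      · simpa [hT j hj, sgn_zero] using hδ j hj k
    push Not at hT
    obtain ⟨j₁, hj₁J, hj₁⟩ := hT
    -- sign consistency on the box by connectivity
    have hcons : ∀ j, ∃ e : Bool, j ∈ J' → t j ≠ 0 →
        (∀ i, D.a i j₀ ≠ 0 → (ε i j₁ == ε i j) = e) ∧ (∀ k, D.b j₀ k ≠ 0 → (δ j₁ k == δ j k) = e) := by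
      intro j
      by_cases hjJ : j ∈ J'
      swap
      · exact ⟨true, fun h => absurd h hjJ⟩
      by_cases htj : t j = 0
      · exact ⟨true, fun _ h => absurd htj h⟩
      obtain ⟨Bad, hBad⟩ : ∃ Bad : ι → ι → Prop, ∀ i k, Bad i k ↔
          (SignEq (D.a i j₀) (D.b j₀ k + t j₁) ∨ SignEq (D.a i j₀) (D.b j₀ k - t j₁) ∨
            SignEq (D.a i j₀) (D.b j₀ k + t j) ∨ SignEq (D.a i j₀) (D.b j₀ k - t j)) :=
        ⟨_, fun _ _ => Iff.rfl⟩
      have hE : ∀ i k, D.a i j₀ ≠ 0 → D.b j₀ k ≠ 0 → ¬ Bad i k → (ε i j₁ == ε i j) = (δ j₁ k == δ j k) := by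
        intro i k hfi hlk hbad
        have hb4 : ¬ (SignEq (D.a i j₀) (D.b j₀ k + t j₁) ∨ SignEq (D.a i j₀) (D.b j₀ k - t j₁) ∨
            SignEq (D.a i j₀) (D.b j₀ k + t j) ∨ SignEq (D.a i j₀) (D.b j₀ k - t j)) :=
          fun h => hbad ((hBad i k).mpr h)
        exact beq_eq_beq_of_shift hG hfi hlk (ε i j₁) (δ j₁ k) (ε i j) (δ j k) (D.adm_eqn i j₀ k)
          (((D.adm_eqn i j₁ k).of_signEq_left (hε i j₁ hj₁J)).of_signEq_mid (hδ j₁ hj₁J k))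
          (((D.adm_eqn i j k).of_signEq_left (hε i j hjJ)).of_signEq_mid (hδ j hjJ k)) hj₁ htj
          (fun h => hb4 (h.elim Or.inl fun h => Or.inr (Or.inl h)))
          (fun h => hb4 (h.elim (fun h => Or.inr (Or.inr (Or.inl h))) fun h => Or.inr (Or.inr (Or.inr h))))
      obtain ⟨BL, hBLmem, hBLcard⟩ : ∃ BL : ι → Finset G,
          (∀ i k, Bad i k → D.b j₀ k ∈ BL i) ∧ ∀ i, (BL i).card ≤ 8 := by
        refine ⟨fun i => ({D.a i j₀ - t j₁, -(D.a i j₀ - t j₁), D.a i j₀ + t j₁, -(D.a i j₀ + t j₁)} : Finset G) ∪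
            {D.a i j₀ - t j, -(D.a i j₀ - t j), D.a i j₀ + t j, -(D.a i j₀ + t j)}, fun i k hik => ?_, fun i => ?_⟩
        · rcases (hBad i k).mp hik with h | h | h | h
          · rcases signEq_row_of_col_add h with (h' | h') | (h' | h') <;> simp [h']
          · rcases signEq_row_of_col_sub h with (h' | h') | (h' | h') <;> simp [h']
          · rcases signEq_row_of_col_add h with (h' | h') | (h' | h') <;> simp [h']
          · rcases signEq_row_of_col_sub h with (h' | h') | (h' | h') <;> simp [h']
        · exact (Finset.card_union_le _ _).trans (Nat.add_le_add Finset.card_le_four Finset.card_le_four)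
      obtain ⟨BF, hBFmem, hBFcard⟩ : ∃ BF : ι → Finset G,
          (∀ i k, Bad i k → D.a i j₀ ∈ BF k) ∧ ∀ k, (BF k).card ≤ 8 := by
        refine ⟨fun k => ({D.b j₀ k + t j₁, -(D.b j₀ k + t j₁), D.b j₀ k - t j₁, -(D.b j₀ k - t j₁)} : Finset G) ∪
            {D.b j₀ k + t j, -(D.b j₀ k + t j), D.b j₀ k - t j, -(D.b j₀ k - t j)}, fun i k hik => ?_, fun k => ?_⟩
        · rcases (hBad i k).mp hik with (h | h) | (h | h) | (h | h) | (h | h) <;> simp [h]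
        · exact (Finset.card_union_le _ _).trans (Nat.add_le_add Finset.card_le_four Finset.card_le_four)
      -- good neighbours from richness
      have hgoodrow : 10 ≤ ((Finset.univ : Finset ι).image fun i => D.a i j₀).card →
          ∀ k, ∃ i, D.a i j₀ ≠ 0 ∧ ¬ Bad i k := by
        intro hf k
        have hS : (insert (0 : G) (BF k)).card ≤ 9 := by
          refine (Finset.card_insert_le _ _).trans ?_
          have := hBFcard k; omega
        have hns : ¬ ((Finset.univ : Finset ι).image fun i => D.a i j₀) ⊆ insert (0 : G) (BF k) := by
          intro hsub; have := Finset.card_le_card hsub; omega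
        obtain ⟨w, hw, hwS⟩ := Finset.not_subset.mp hns
        obtain ⟨i, -, rfl⟩ := Finset.mem_image.mp hw
        simp only [Finset.mem_insert, not_or] at hwS
        exact ⟨i, fun h => hwS.1 h, fun h => hwS.2 (hBFmem i k h)⟩
      have hgoodcol : 10 ≤ ((Finset.univ : Finset ι).image fun k => D.b j₀ k).card →
          ∀ i, ∃ k, D.b j₀ k ≠ 0 ∧ ¬ Bad i k := by
        intro hl i
        have hS : (insert (0 : G) (BL i)).card ≤ 9 := by
          refine (Finset.card_insert_le _ _).trans ?_
          have := hBLcard i; omega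
        have hns : ¬ ((Finset.univ : Finset ι).image fun k => D.b j₀ k) ⊆ insert (0 : G) (BL i) := by
          intro hsub; have := Finset.card_le_card hsub; omega
        obtain ⟨w, hw, hwS⟩ := Finset.not_subset.mp hns
        obtain ⟨k, -, rfl⟩ := Finset.mem_image.mp hw
        simp only [Finset.mem_insert, not_or] at hwS
        exact ⟨k, fun h => hwS.1 h, fun h => hwS.2 (hBLmem i k h)⟩
      have hcommonrow : 18 ≤ ((Finset.univ : Finset ι).image fun k => D.b j₀ k).card →
          ∀ i i', ∃ k, D.b j₀ k ≠ 0 ∧ ¬ Bad i k ∧ ¬ Bad i' k := by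
        intro hl i i'
        have hS : (insert (0 : G) (BL i ∪ BL i')).card ≤ 17 := by
          refine (Finset.card_insert_le _ _).trans ?_
          have := Finset.card_union_le (BL i) (BL i'); have := hBLcard i; have := hBLcard i'; omega
        have hns : ¬ ((Finset.univ : Finset ι).image fun k => D.b j₀ k) ⊆ insert (0 : G) (BL i ∪ BL i') := by
          intro hsub; have := Finset.card_le_card hsub; omega
        obtain ⟨w, hw, hwS⟩ := Finset.not_subset.mp hns
        obtain ⟨k, -, rfl⟩ := Finset.mem_image.mp hw
        simp only [Finset.mem_insert, Finset.mem_union, not_or] at hwS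
        exact ⟨k, fun h => hwS.1 h, fun h => hwS.2.1 (hBLmem i k h), fun h => hwS.2.2 (hBLmem i' k h)⟩
      have hcommoncol : 18 ≤ ((Finset.univ : Finset ι).image fun i => D.a i j₀).card →
          ∀ k k', ∃ i, D.a i j₀ ≠ 0 ∧ ¬ Bad i k ∧ ¬ Bad i k' := by
        intro hf k k'
        have hS : (insert (0 : G) (BF k ∪ BF k')).card ≤ 17 := by
          refine (Finset.card_insert_le _ _).trans ?_
          have := Finset.card_union_le (BF k) (BF k'); have := hBFcard k; have := hBFcard k'; omega
        have hns : ¬ ((Finset.univ : Finset ι).image fun i => D.a i j₀) ⊆ insert (0 : G) (BF k ∪ BF k') := by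
          intro hsub; have := Finset.card_le_card hsub; omega
        obtain ⟨w, hw, hwS⟩ := Finset.not_subset.mp hns
        obtain ⟨i, -, rfl⟩ := Finset.mem_image.mp hw
        simp only [Finset.mem_insert, Finset.mem_union, not_or] at hwS
        exact ⟨i, fun h => hwS.1 h, fun h => hwS.2.1 (hBFmem i k h), fun h => hwS.2.2 (hBFmem i k' h)⟩
      -- constancy, in either direction
      rcases hrich with ⟨hf10, hl18⟩ | ⟨hf18, hl10⟩
      · obtain ⟨i₀, hi₀, -⟩ := hgoodrow hf10 j₀
        refine ⟨(ε i₀ j₁ == ε i₀ j), fun _ _ => ?_⟩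
        have hrows : ∀ i, D.a i j₀ ≠ 0 → (ε i j₁ == ε i j) = (ε i₀ j₁ == ε i₀ j) := by
          intro i hfi
          obtain ⟨k, hlk, hik, hi₀k⟩ := hcommonrow hl18 i i₀
          rw [hE i k hfi hlk hik, hE i₀ k hi₀ hlk hi₀k]
        refine ⟨hrows, fun k hlk => ?_⟩
        obtain ⟨i, hfi, hik⟩ := hgoodrow hf10 k
        rw [← hE i k hfi hlk hik, hrows i hfi]
      · obtain ⟨k₀, hk₀, -⟩ := hgoodcol hl10 j₀
        refine ⟨(δ j₁ k₀ == δ j k₀), fun _ _ => ?_⟩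
        have hcols : ∀ k, D.b j₀ k ≠ 0 → (δ j₁ k == δ j k) = (δ j₁ k₀ == δ j k₀) := by
          intro k hlk
          obtain ⟨i, hfi, hik, hik₀⟩ := hcommoncol hf18 k k₀
          rw [← hE i k hfi hlk hik, ← hE i k₀ hfi hk₀ hik₀]
        refine ⟨fun i hfi => ?_, hcols⟩
        obtain ⟨k, hlk, hik⟩ := hgoodcol hl10 i
        rw [hE i k hfi hlk hik, hcols k hlk]
    choose e he using hcons
    refine ⟨fun i => sgn (!(ε i j₁)) (D.a i j₀), fun j => if e j then -(t j) else t j,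
      fun k => sgn (δ j₁ k) (D.b j₀ k), fun i j hj => ?_, fun j hj k => ?_⟩
    · -- (L1)
      show SignEq (D.a i j) (sgn (!(ε i j₁)) (D.a i j₀) + (if e j then -(t j) else t j))
      by_cases htj : t j = 0
      · have h := hε i j hj
        rw [htj, sgn_zero, add_zero] at h
        rw [htj, neg_zero, ite_self, add_zero]
        exact h.trans (signEq_sgn _ _).symm
      by_cases hfi : D.a i j₀ = 0
      · have h := hε i j hj
        rw [hfi, zero_add] at h
        rw [hfi, sgn_zero, zero_add]
        have h' : SignEq (D.a i j) (t j) := h.trans (signEq_sgn _ _)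
        split_ifs
        · exact signEq_neg_right.mpr h'
        · exact h'
      · obtain ⟨hεe, -⟩ := he j hj htj
        rcases beq_cases (hεe i hfi) with ⟨hej, hεij⟩ | ⟨hej, hεij⟩
        · rw [if_pos hej]
          have h := hε i j hj
          rw [hεij] at h
          exact h.trans (gauge_a_same _ _ _)
        · rw [if_neg (by rw [hej]; decide)]
          have h := hε i j hj
          rw [hεij] at h
          exact h.trans (gauge_a_opp _ _ _)
    · -- (L2)
      show SignEq (D.b j k) (sgn (δ j₁ k) (D.b j₀ k) - (if e j then -(t j) else t j))
      by_cases htj : t j = 0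
      · have h := hδ j hj k
        rw [htj, sgn_zero, add_zero] at h
        rw [htj, neg_zero, ite_self, sub_zero]
        exact h.trans (signEq_sgn _ _).symm
      by_cases hlk : D.b j₀ k = 0
      · have h := hδ j hj k
        rw [hlk, zero_add] at h
        rw [hlk, sgn_zero, zero_sub]
        have h' : SignEq (D.b j k) (t j) := h.trans (signEq_sgn _ _)
        split_ifs
        · rw [neg_neg]; exact h'
        · exact signEq_neg_right.mpr h'
      · obtain ⟨-, hδe⟩ := he j hj htj
        rcases beq_cases (hδe k hlk) with ⟨hej, hδjk⟩ | ⟨hej, hδjk⟩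
        · rw [if_pos hej]
          have h := hδ j hj k
          rw [hδjk] at h
          exact h.trans (gauge_b_same _ _ _)
        · rw [if_neg (by rw [hej]; decide)]
          have h := hδ j hj k
          rw [hδjk] at h
          exact h.trans (gauge_b_opp _ _ _)
  -- endings on the box
  rcases J'.eq_empty_or_nonempty with hJe | ⟨ja, hja⟩
  · simp [hJe]
  by_cases hbig : ∃ γ : G, J'.card ≤ 3 * (J'.filter fun j => g j = γ).card
  · obtain ⟨γ, hγ⟩ := hbig
    have h := D.sq_mul_card_le_of_level_on Φ κ hκ hsep g l (J'.filter fun j => g j = γ)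
      (fun j hj k => hb' j (Finset.mem_filter.mp hj).1 k) (by
        intro j hj j' hj'
        rw [(Finset.mem_filter.mp hj).2, (Finset.mem_filter.mp hj').2])
    calc Fintype.card ι ^ 2 * J'.card
        ≤ Fintype.card ι ^ 2 * (3 * (J'.filter fun j => g j = γ).card) := Nat.mul_le_mul_left _ hγ
      _ = 3 * (Fintype.card ι ^ 2 * (J'.filter fun j => g j = γ).card) := by ring
      _ ≤ 3 * (Fintype.card R * Fintype.card G₀) := Nat.mul_le_mul_left _ h
  · push Not at hbig
    obtain ⟨jb, hjb, hjb'⟩ := Finset.exists_mem_notMem_of_card_lt_card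
      (s := J'.filter fun j => g j = g ja) (t := J') (by have := hbig (g ja); omega)
    have hab : g ja ≠ g jb := by
      intro h; apply hjb'; exact Finset.mem_filter.mpr ⟨hjb, h.symm⟩
    obtain ⟨jc, hjc, hjc'⟩ := Finset.exists_mem_notMem_of_card_lt_card
      (s := (J'.filter fun j => g j = g ja) ∪ (J'.filter fun j => g j = g jb)) (t := J') (by
        have := hbig (g ja); have := hbig (g jb)
        have := Finset.card_union_le (J'.filter fun j => g j = g ja) (J'.filter fun j => g j = g jb)
        omega)
    have hac : g ja ≠ g jc := by
      intro h; apply hjc'; exact Finset.mem_union.mpr (Or.inl (Finset.mem_filter.mpr ⟨hjc, h.symm⟩))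
    have hbc : g jb ≠ g jc := by
      intro h; apply hjc'; exact Finset.mem_union.mpr (Or.inr (Finset.mem_filter.mpr ⟨hjc, h.symm⟩))
    calc Fintype.card ι ^ 2 * J'.card ≤ 2 * (Fintype.card R * Fintype.card G₀) :=
          D.sq_mul_card_le_two_mul_of_locked_three_on hG Φ κ hκ hsep f g l J' ha' hb' hja hjb hjc hab hac hbc
      _ ≤ 3 * (Fintype.card R * Fintype.card G₀) := by omega

/-! ### The semi-rich poor world -/

/-- **Semi-rich base, rich b-row.** If row `j₀` of `b` takes `≥ 18` values and column `j₀` of `a` takes `≥ 10`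
values, then `n² · |J′| ≤ 3 · r · |S⁰|` for every set `J′` of indices whose a-columns take `≥ 17` values (they are
all locked to `j₀`). [this work, §8.8 (T13)(g2)] -/
theorem Data.sq_mul_card_le_three_mul_of_semirich_row [Fintype ι] [DecidableEq ι] [Fintype G₀]
    [DecidableEq G₀] [Fintype G] [DecidableEq G] {R : Type*} [Fintype R] [DecidableEq R]
    (hG : ∀ x : G, x = -x → x = 0) (D : Data ι G) (Φ : Chart ι G₀) (κ : G → R)
    (hκ : ∀ x y, κ x = κ y ↔ SignEq x y) (hsep : D.SepAll Φ) (j₀ : ι)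
    (hl : 18 ≤ ((Finset.univ : Finset ι).image fun k => D.b j₀ k).card)
    (hf : 10 ≤ ((Finset.univ : Finset ι).image fun i => D.a i j₀).card) (J' : Finset ι)
    (hJ : ∀ j ∈ J', 17 ≤ ((Finset.univ : Finset ι).image fun i => D.a i j).card) :
    Fintype.card ι ^ 2 * J'.card ≤ 3 * (Fintype.card R * Fintype.card G₀) := by
  classical
  have key : ∀ j, ∃ t : G, j ∈ J' →
      (∀ i, SignEq (D.a i j) (D.a i j₀ + t) ∨ SignEq (D.a i j) (D.a i j₀ - t)) ∧
      (∀ k, SignEq (D.b j k) (D.b j₀ k + t) ∨ SignEq (D.b j k) (D.b j₀ k - t)) := by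
    intro j
    by_cases hj : j ∈ J'
    · obtain ⟨t, ht⟩ := D.locked_of_rich_pair hG κ hκ j₀ j (Or.inr (hJ j hj)) (Or.inl (by omega))
      exact ⟨t, fun _ => ht⟩
    · exact ⟨0, fun h => absurd h hj⟩
  choose t ht using key
  exact D.sq_mul_card_le_three_mul_of_locked_rich_on hG Φ κ (fun x y => (hκ x y).mp) hsep j₀ t J'
    (fun i j hj => (ht j hj).1 i) (fun j hj k => (ht j hj).2 k) (Or.inl ⟨hf, hl⟩)

/-- **Semi-rich base, rich a-column.** If column `j₀` of `a` takes `≥ 18` values and row `j₀` of `b` takes `≥ 10`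
values, then `n² · |J′| ≤ 3 · r · |S⁰|` for every set `J′` of indices whose b-rows take `≥ 17` values.
[this work, §8.8 (T13)(g2)] -/
theorem Data.sq_mul_card_le_three_mul_of_semirich_col [Fintype ι] [DecidableEq ι] [Fintype G₀]
    [DecidableEq G₀] [Fintype G] [DecidableEq G] {R : Type*} [Fintype R] [DecidableEq R]
    (hG : ∀ x : G, x = -x → x = 0) (D : Data ι G) (Φ : Chart ι G₀) (κ : G → R)
    (hκ : ∀ x y, κ x = κ y ↔ SignEq x y) (hsep : D.SepAll Φ) (j₀ : ι)
    (hf : 18 ≤ ((Finset.univ : Finset ι).image fun i => D.a i j₀).card)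
    (hl : 10 ≤ ((Finset.univ : Finset ι).image fun k => D.b j₀ k).card) (J' : Finset ι)
    (hJ : ∀ j ∈ J', 17 ≤ ((Finset.univ : Finset ι).image fun k => D.b j k).card) :
    Fintype.card ι ^ 2 * J'.card ≤ 3 * (Fintype.card R * Fintype.card G₀) := by
  classical
  have key : ∀ j, ∃ t : G, j ∈ J' →
      (∀ i, SignEq (D.a i j) (D.a i j₀ + t) ∨ SignEq (D.a i j) (D.a i j₀ - t)) ∧
      (∀ k, SignEq (D.b j k) (D.b j₀ k + t) ∨ SignEq (D.b j k) (D.b j₀ k - t)) := by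
    intro j
    by_cases hj : j ∈ J'
    · obtain ⟨t, ht⟩ := D.locked_of_rich_pair hG κ hκ j₀ j (Or.inl (by omega)) (Or.inr (hJ j hj))
      exact ⟨t, fun _ => ht⟩
    · exact ⟨0, fun h => absurd h hj⟩
  choose t ht using key
  exact D.sq_mul_card_le_three_mul_of_locked_rich_on hG Φ κ (fun x y => (hκ x y).mp) hsep j₀ t J'
    (fun i j hj => (ht j hj).1 i) (fun j hj k => (ht j hj).2 k) (Or.inr ⟨hf, hl⟩)

end FibreLines

end Summit.MatrixMultiplication.MatrixMultiplication.Theorems.TwistedTPP
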